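import Summits.RiemannHypothesis.RiemannHypothesis.Theorems.HardyZLehmerSplitDictionarystub_partialFraction
import Summits.RiemannHypothesis.RiemannHypothesis.Theorems.HardyZLehmerSplitDictionaryKernelBoundHelper
import HarnessLib

/-!
# Helper lemmas for stub_farField

This file proves helper lemmas for the far-field bound `|farSum t| ≤ 20 log t + 50`.

* `three_half_div_sq_le_three_div_one_add_sq`: (3/2)/x² ≤ 3/(1+x²) for |x|≥1
* `outside_window_dist'`: |t-γ| ≥ 1 for ρ outside window (t ≥ 100)
* `farTerm_abs_le`: |farTerm t ρ| ≤ 3m(ρ)/(1+(t-γ)²) for zeros outside window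
* `farTerm_abs_le_all`: same bound for all zeros (0 in window)
-/

noncomputable section

open Complex Set Filter Topology Classical Real BigOperators
open Literature.NumberTheory.LFunctions

namespace StubFarFieldHelpers

/-- For |x| ≥ 1: (3/2)/x² ≤ 3/(1+x²). -/
lemma three_half_div_sq_le_three_div_one_add_sq {x : ℝ} (h : 1 ≤ |x|) :
    3 / 2 / x ^ 2 ≤ 3 / (1 + x ^ 2) := by
  have hx2 : 1 ≤ x ^ 2 := by nlinarith [sq_abs x]
  have hpos1 : 0 < x ^ 2 := by positivity
  have hpos2 : 0 < 1 + x ^ 2 := by positivity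
  rw [div_le_div_iff₀ hpos1 hpos2]
  nlinarith

/-- For t ≥ 100 and ρ outside window, |t - γ| ≥ 1. -/
lemma outside_window_dist' {t : ℝ} (ht : 100 ≤ t) (ρ : RHWave0.riemannZetaNontrivialZeros)
    (hout : (ρ : ℂ) ∉ window t) : 1 ≤ |t - (ρ : ℂ).im| := by
  unfold window zetaZeroBox at hout
  simp only [Set.mem_sdiff, Set.mem_setOf_eq] at hout
  have hρ := ρ.2
  have hzero := ZetaZeros.riemannZetaNontrivialZeros.zeta_eq_zero hρ
  have hre_pos := ZetaZeros.riemannZetaNontrivialZeros.re_pos hρ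
  have hre_lt := ZetaZeros.riemannZetaNontrivialZeros.re_lt_one hρ
  have him_ne := ZetaZeros.riemannZetaNontrivialZeros.im_ne_zero hρ
  by_cases hpos : 0 < (ρ : ℂ).im
  · by_cases h1 : (ρ : ℂ).im ≤ t + 1
    · have hmem : (ρ : ℂ) ∈ zetaZeroBox 0 (t + 1) := ⟨hzero, hre_pos.le, hre_lt.le, hpos, h1⟩
      have hlower : (ρ : ℂ).im ≤ t - 1 := by
        by_contra h
        simp only [not_le] at h
        have hnotlb : (ρ : ℂ) ∉ zetaZeroBox 0 (t - 1) := fun hmem2 =>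
          have := hmem2.2.2.2.2
          by linarith
        have : (ρ : ℂ) ∈ window t := by
          unfold window zetaZeroBox
          simp only [Set.mem_sdiff, Set.mem_setOf_eq]
          exact ⟨⟨hzero, hre_pos.le, hre_lt.le, hpos, h1⟩, hnotlb⟩
        exact hout this
      have h4 : |t - (ρ : ℂ).im| = t - (ρ : ℂ).im := abs_of_nonneg (by linarith)
      rw [h4]; linarith
    · simp only [not_le] at h1
      have h3 : |t - (ρ : ℂ).im| = (ρ : ℂ).im - t := by
        rw [abs_sub_comm]; exact abs_of_pos (by linarith)
      rw [h3]; linarith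
  · have hneg : (ρ : ℂ).im < 0 := lt_of_le_of_ne (not_lt.1 hpos) him_ne
    have h : |t - (ρ : ℂ).im| = t - (ρ : ℂ).im := abs_of_pos (by linarith)
    rw [h]; linarith

/-- |farTerm t ρ| ≤ 3 m(ρ)/(1 + (γ-t)²) for zeros outside the window. -/
lemma farTerm_abs_le {t : ℝ} (ht : 100 ≤ t) (ρ : RHWave0.riemannZetaNontrivialZeros)
    (hout : (ρ : ℂ) ∉ window t) :
    |farTerm t ρ| ≤ 3 * (riemannZetaZeroOrder (ρ : ℂ) : ℝ) / (1 + (t - (ρ : ℂ).im) ^ 2) := by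
  unfold farTerm
  simp only [hout, ↓reduceIte]
  have hm := ZetaZeroSum.zeroOrder_nonneg ρ
  rw [abs_mul, abs_of_nonneg hm]
  have hge1 : 1 ≤ |t - (ρ : ℂ).im| := outside_window_dist' ht ρ hout
  have hkb := StubFarFieldHelper.kernel_bound_tight hge1
  have hK : kernel t (ρ : ℂ) = StubFarFieldHelper.kernel t (ρ : ℂ) := rfl
  rw [hK]
  have hconv := three_half_div_sq_le_three_div_one_add_sq hge1
  calc (riemannZetaZeroOrder (ρ : ℂ) : ℝ) * |StubFarFieldHelper.kernel t (ρ : ℂ)|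
      ≤ (riemannZetaZeroOrder (ρ : ℂ) : ℝ) * (3 / 2 / (t - (ρ : ℂ).im) ^ 2) :=
        mul_le_mul_of_nonneg_left hkb hm
    _ ≤ (riemannZetaZeroOrder (ρ : ℂ) : ℝ) * (3 / (1 + (t - (ρ : ℂ).im) ^ 2)) :=
        mul_le_mul_of_nonneg_left hconv hm
    _ = 3 * (riemannZetaZeroOrder (ρ : ℂ) : ℝ) / (1 + (t - (ρ : ℂ).im) ^ 2) := by ring

/-- |farTerm t ρ| ≤ 3 m(ρ)/(1 + (γ-t)²) for ALL zeros (inside window: farTerm = 0). -/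
lemma farTerm_abs_le_all {t : ℝ} (ht : 100 ≤ t) (ρ : RHWave0.riemannZetaNontrivialZeros) :
    |farTerm t ρ| ≤ 3 * (riemannZetaZeroOrder (ρ : ℂ) : ℝ) / (1 + (t - (ρ : ℂ).im) ^ 2) := by
  by_cases h : (ρ : ℂ) ∈ window t
  · unfold farTerm; simp only [h, ↓reduceIte, abs_zero]
    have hm := ZetaZeroSum.zeroOrder_nonneg ρ
    positivity
  · exact farTerm_abs_le ht ρ h

end StubFarFieldHelpers

end
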